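import Summits.ValiantsHypothesis.ValiantsHypothesis.Theses.ElementaryWordLength

/-!
# Route ElementaryWordLength · support item `BocSimulation` (stmt-ValiantsHypothesis-6629)

Ben-Or–Cleve's register simulation (M. Ben-Or, R. Cleve, *Computing algebraic formulas using a
constant number of registers*, SIAM J. Comput. 21 (1992), Thm. 1; Bürgisser–Clausen–Shokrollahi
1997, Ex. 21.6) on the tree's straight-line circuits
`Literature.Computability.AlgebraicComplexity.ArithCircuit`: a fan-in-≤2 circuit of depth `d`
computing `f` yields a word of at most `4 ^ d` elementary letters `E_ij(λ)` / `E_ij(λ·x_v)`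
(`i ≠ j`) whose product is the transvection `E_02(f) = 1 + f·e_02 ∈ SL_3(R[x])` — the route decl
`Summit.ValiantsHypothesis.ValiantsHypothesis.Theses.ElementaryWordLength.BocSimulation`
(there over `ℂ`; everything below is proved over any commutative ring `R`).

## Proof

We prove Ben-Or–Cleve's "offset" form of the invariant: for every gate value `g` of depth `d`,
EVERY ordered pair `i ≠ i'` in `Fin 3` and EVERY scalar `c` there is an admissible word of
length `≤ 4 ^ d` with product `E_{i i'}(C c * g)`, by reverse induction on the gate list (the
semantics `gateValues` and the depths `gateWDepths` are left folds read with `List.getD · 0`).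
* leaves: `E_{i i'}(c · X v)` and `E_{i i'}(c · a)` are single letters; junk (forward or
  out-of-range) gate references have value `0` and depth `0`, and `E(0) = 1` is the empty word;
* sum gates (≤ 2 summands `c₁ • u₁ + c₂ • u₂`): concatenate, `E(a) E(b) = E(a + b)`, the scalars
  being absorbed into the offsets `c · c₁`, `c · c₂`;
* product gates (≤ 2 factors): the Steinberg commutator
  `E_{ik}(a) E_{ki'}(b) E_{ik}(-a) E_{ki'}(-b) = E_{ii'}(a b)` with `k` the third index — four
  sub-words of length `≤ 4 ^ (d - 1)` each (`transvection_commutator`).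
In this offset form no conjugation by diagonal or permutation matrices is needed. The final
statement is the case `(i, i') = (0, 2)`, `c = 1` at the output operand.
-/

noncomputable section

-- single-conjunct layout: Sub = Summit, duplicated namespace component intended
set_option linter.dupNamespace false

namespace Summit.ValiantsHypothesis.ValiantsHypothesis.Theorems.ElementaryWordLengthBocSimulation

open Literature.Computability.AlgebraicComplexity
open Literature.Computability.AlgebraicComplexity.ArithCircuit
open MvPolynomial Matrix

universe u v

variable {R : Type u} [CommRing R] {σ : Type v}

/-! ### The Steinberg commutator relation in `E_3(R)` -/

/-- The Steinberg commutator relation for elementary matrices over a commutative ring: for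
pairwise distinct indices `i, k, j`,
`E_{ik}(a) · E_{kj}(b) · E_{ik}(-a) · E_{kj}(-b) = E_{ij}(a b)` (Ben-Or–Cleve 1992, proof of
Thm. 1; Hahn–O'Meara, *The classical groups and K-theory*, (1.2.C3)). -/
theorem transvection_commutator {n : Type*} [Fintype n] [DecidableEq n] {i k j : n}
    (hik : i ≠ k) (hkj : k ≠ j) (hij : i ≠ j) (a b : R) :
    transvection i k a * transvection k j b * transvection i k (-a) * transvection k j (-b) =
      transvection i j (a * b) := by
  simp only [transvection, mul_add, add_mul, one_mul, mul_one, single_mul_single_same,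
    single_mul_single_of_ne _ _ _ _ hik.symm, single_mul_single_of_ne _ _ _ _ hkj.symm,
    single_mul_single_of_ne _ _ _ _ hij.symm, add_zero, ← single_neg, mul_neg, neg_mul]
  abel

/-- In `Fin 3` every ordered pair of distinct indices has a third index (the auxiliary register
of Ben-Or–Cleve 1992, Thm. 1). -/
theorem exists_third_index {i i' : Fin 3} (h : i ≠ i') : ∃ k : Fin 3, k ≠ i ∧ k ≠ i' := by
  revert i i'
  decide

/-! ### Words: the empty word, letters, concatenation -/

/-- The empty word is admissible, has every length bound, and multiplies to `1 = E(0)`. -/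
theorem word_one (B : ℕ) :
    ∃ w : List (Fin 3 × Fin 3 × R × Option σ), w.length ≤ B ∧ (∀ l ∈ w, l.1 ≠ l.2.1) ∧
      (w.map fun l => transvection l.1 l.2.1 (C l.2.2.1 * l.2.2.2.elim 1 X)).prod =
        (1 : Matrix (Fin 3) (Fin 3) (MvPolynomial σ R)) :=
  ⟨[], Nat.zero_le _, by simp, by simp⟩

/-- A single letter `(i, i', c, o)` is an admissible word of length `1` for
`E_{i i'}(C c * m)`, `m = 1` or `m = X v` (the leaves of Ben-Or–Cleve 1992, Thm. 1). -/
theorem word_letter {i i' : Fin 3} (h : i ≠ i') (c : R) (o : Option σ) :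
    ∃ w : List (Fin 3 × Fin 3 × R × Option σ), w.length ≤ 1 ∧ (∀ l ∈ w, l.1 ≠ l.2.1) ∧
      (w.map fun l => transvection l.1 l.2.1 (C l.2.2.1 * l.2.2.2.elim 1 X)).prod =
        transvection i i' (C c * o.elim 1 X) :=
  ⟨[(i, i', c, o)], le_rfl, by simpa using h, by simp⟩

/-- Concatenation of words multiplies their products and adds their lengths. -/
theorem word_mul {B₁ B₂ : ℕ} {M N : Matrix (Fin 3) (Fin 3) (MvPolynomial σ R)}
    (hM : ∃ w : List (Fin 3 × Fin 3 × R × Option σ), w.length ≤ B₁ ∧ (∀ l ∈ w, l.1 ≠ l.2.1) ∧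
      (w.map fun l => transvection l.1 l.2.1 (C l.2.2.1 * l.2.2.2.elim 1 X)).prod = M)
    (hN : ∃ w : List (Fin 3 × Fin 3 × R × Option σ), w.length ≤ B₂ ∧ (∀ l ∈ w, l.1 ≠ l.2.1) ∧
      (w.map fun l => transvection l.1 l.2.1 (C l.2.2.1 * l.2.2.2.elim 1 X)).prod = N) :
    ∃ w : List (Fin 3 × Fin 3 × R × Option σ), w.length ≤ B₁ + B₂ ∧ (∀ l ∈ w, l.1 ≠ l.2.1) ∧
      (w.map fun l => transvection l.1 l.2.1 (C l.2.2.1 * l.2.2.2.elim 1 X)).prod = M * N := by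
  obtain ⟨w₁, h₁, hv₁, hp₁⟩ := hM
  obtain ⟨w₂, h₂, hv₂, hp₂⟩ := hN
  refine ⟨w₁ ++ w₂, by simpa using Nat.add_le_add h₁ h₂, ?_, ?_⟩
  · intro l hl
    rcases List.mem_append.1 hl with hl | hl
    exacts [hv₁ l hl, hv₂ l hl]
  · rw [List.map_append, List.prod_append, hp₁, hp₂]

/-! ### The simulation, operand by operand and gate by gate -/

/-- An element of a list is bounded by the `max`-fold of the list (bookkeeping for the depth of
a gate, `1 + max (depths of its operands)`). -/
theorem le_foldr_max_of_mem {α : Type*} (f : α → ℕ) {l : List α} {x : α} (hx : x ∈ l) :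
    f x ≤ (l.map f).foldr max 0 := by
  induction l with
  | nil => simp at hx
  | cons y l ih =>
    rw [List.map_cons, List.foldr_cons]
    rcases List.mem_cons.1 hx with rfl | hx
    · exact le_max_left _ _
    · exact (ih hx).trans (le_max_right _ _)

/-- The arithmetic of Ben-Or–Cleve's length bound: two (sum gate) or four (product gate)
sub-words of length `≤ 4 ^ D` fit into `4 ^ (1 + D)`. -/
theorem four_pow_bound {d e D : ℕ} (hd : d ≤ D) (he : e ≤ D) :
    4 ^ d + 4 ^ e + 4 ^ d + 4 ^ e ≤ 4 ^ (1 + D) := by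
  have h₁ : 4 ^ d ≤ 4 ^ D := Nat.pow_le_pow_right (by norm_num) hd
  have h₂ : 4 ^ e ≤ 4 ^ D := Nat.pow_le_pow_right (by norm_num) he
  rw [pow_add, pow_one]
  omega

/-- **Operands** (Ben-Or–Cleve 1992, Thm. 1, leaves and recursive calls). Given the offset
invariant for all gate references (read with `List.getD · 0` against the values `vals` and
depths `ds` of the gates computed so far), every operand `u` has, for every pair `i ≠ i'` and
scalar `c`, an admissible word of length `≤ 4 ^ depth(u)` for `E_{i i'}(C c * u.eval vals)`. -/
theorem word_of_operand (vals : List (MvPolynomial σ R)) (ds : List ℕ)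
    (hinv : ∀ (j : ℕ) (i i' : Fin 3), i ≠ i' → ∀ c : R,
      ∃ w : List (Fin 3 × Fin 3 × R × Option σ), w.length ≤ 4 ^ ds.getD j 0 ∧
        (∀ l ∈ w, l.1 ≠ l.2.1) ∧
        (w.map fun l => transvection l.1 l.2.1 (C l.2.2.1 * l.2.2.2.elim 1 X)).prod =
          transvection i i' (C c * vals.getD j 0))
    (u : Operand R σ) {i i' : Fin 3} (h : i ≠ i') (c : R) :
    ∃ w : List (Fin 3 × Fin 3 × R × Option σ), w.length ≤ 4 ^ u.depthIn ds ∧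
      (∀ l ∈ w, l.1 ≠ l.2.1) ∧
      (w.map fun l => transvection l.1 l.2.1 (C l.2.2.1 * l.2.2.2.elim 1 X)).prod =
        transvection i i' (C c * u.eval vals) := by
  cases u with
  | var v =>
    obtain ⟨w, hw, hv, hp⟩ := word_letter (R := R) h c (some v)
    refine ⟨w, ?_, hv, ?_⟩
    · simpa [Operand.depthIn] using hw
    · rw [hp]
      simp [Operand.eval]
  | const a =>
    obtain ⟨w, hw, hv, hp⟩ := word_letter (σ := σ) h (c * a) none
    refine ⟨w, ?_, hv, ?_⟩
    · simpa [Operand.depthIn] using hw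
    · rw [hp]
      simp [Operand.eval, C_mul]
  | gate j =>
    simpa [Operand.depthIn, Operand.eval] using hinv j i i' h c

/-- **Gates** (Ben-Or–Cleve 1992, Thm. 1, the two recursive cases). Under the offset invariant
for the earlier gates, a gate `g` of fan-in `≤ 2` has, for every pair `i ≠ i'` and scalar `c`, an
admissible word of length `≤ 4 ^ (1 + max depths)` for `E_{i i'}(C c * g.eval vals)`: a sum gate
concatenates the words of its (rescaled) summands, a product gate is the Steinberg commutator of
`E_{ik}(c · u)` and `E_{ki'}(v)` through the third index `k`. -/
theorem word_of_gate (vals : List (MvPolynomial σ R)) (ds : List ℕ)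
    (hinv : ∀ (j : ℕ) (i i' : Fin 3), i ≠ i' → ∀ c : R,
      ∃ w : List (Fin 3 × Fin 3 × R × Option σ), w.length ≤ 4 ^ ds.getD j 0 ∧
        (∀ l ∈ w, l.1 ≠ l.2.1) ∧
        (w.map fun l => transvection l.1 l.2.1 (C l.2.2.1 * l.2.2.2.elim 1 X)).prod =
          transvection i i' (C c * vals.getD j 0))
    (g : Gate R σ) (hg : g.fanIn ≤ 2) {i i' : Fin 3} (h : i ≠ i') (c : R) :
    ∃ w : List (Fin 3 × Fin 3 × R × Option σ),
      w.length ≤ 4 ^ (1 + (g.args.map (Operand.depthIn ds)).foldr max 0) ∧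
      (∀ l ∈ w, l.1 ≠ l.2.1) ∧
      (w.map fun l => transvection l.1 l.2.1 (C l.2.2.1 * l.2.2.2.elim 1 X)).prod =
        transvection i i' (C c * g.eval vals) := by
  have hop := word_of_operand vals ds hinv
  have hD : ∀ u ∈ g.args, Operand.depthIn ds u ≤ (g.args.map (Operand.depthIn ds)).foldr max 0 :=
    fun u hu => le_foldr_max_of_mem _ hu
  generalize (g.args.map (Operand.depthIn ds)).foldr max 0 = D at hD ⊢
  have hD1 : ∀ d, d ≤ D → 4 ^ d ≤ 4 ^ (1 + D) := fun d hd =>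
    Nat.pow_le_pow_right (by norm_num) (by omega)
  cases g with
  | sum args =>
    rcases args with _ | ⟨a, _ | ⟨b, _ | ⟨e, rest⟩⟩⟩
    · -- empty sum: value `0`, the empty word
      obtain ⟨w, hw, hv, hp⟩ := word_one (R := R) (σ := σ) 0
      refine ⟨w, hw.trans (Nat.zero_le _), hv, ?_⟩
      rw [hp]
      simp [Gate.eval]
    · -- one summand `a.1 • a.2`
      obtain ⟨w, hw, hv, hp⟩ := hop a.2 h (c * a.1)
      refine ⟨w, hw.trans (hD1 _ (hD a.2 (by simp [Gate.args]))), hv, ?_⟩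
      rw [hp]
      simp only [Gate.eval, List.map_cons, List.map_nil, List.sum_cons, List.sum_nil, add_zero,
        smul_eq_C_mul, C_mul, mul_assoc]
    · -- two summands `a.1 • a.2 + b.1 • b.2`: concatenate
      have hab := word_mul (hop a.2 h (c * a.1)) (hop b.2 h (c * b.1))
      obtain ⟨w, hw, hv, hp⟩ := hab
      refine ⟨w, hw.trans ?_, hv, ?_⟩
      · have := four_pow_bound (hD a.2 (by simp [Gate.args])) (hD b.2 (by simp [Gate.args]))
        omega
      · rw [hp, transvection_mul_transvection_same _ _ h]
        congr 1
        simp only [Gate.eval, List.map_cons, List.map_nil, List.sum_cons, List.sum_nil, add_zero,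
          smul_eq_C_mul, C_mul, mul_add]
        ring
    · -- fan-in ≥ 3 is excluded
      simp [Gate.fanIn, Gate.args] at hg
  | prod args =>
    rcases args with _ | ⟨u, _ | ⟨v, _ | ⟨e, rest⟩⟩⟩
    · -- empty product: value `1`, one letter `E_{i i'}(c)`
      obtain ⟨w, hw, hv, hp⟩ := word_letter (σ := σ) h c none
      refine ⟨w, hw.trans (Nat.one_le_pow _ _ (by norm_num)), hv, ?_⟩
      rw [hp]
      simp [Gate.eval]
    · -- one factor
      obtain ⟨w, hw, hv, hp⟩ := hop u h c
      refine ⟨w, hw.trans (hD1 _ (hD u (by simp [Gate.args]))), hv, ?_⟩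
      rw [hp]
      simp [Gate.eval]
    · -- two factors: the Steinberg commutator through the third index `k`
      obtain ⟨k, hki, hki'⟩ := exists_third_index h
      have h4 := word_mul (word_mul (word_mul (hop u hki.symm c) (hop v hki' 1))
        (hop u hki.symm (-c))) (hop v hki' (-1))
      obtain ⟨w, hw, hv, hp⟩ := h4
      refine ⟨w, hw.trans ?_, hv, ?_⟩
      · have := four_pow_bound (hD u (by simp [Gate.args])) (hD v (by simp [Gate.args]))
        omega
      · rw [hp]
        have hu : C (-c) * u.eval vals = -(C c * u.eval vals) := by simp
        have hv' : C (-1) * v.eval vals = -(C 1 * v.eval vals) := by simp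
        rw [hu, hv', transvection_commutator hki.symm hki' h]
        congr 1
        simp [Gate.eval, mul_assoc]
    · -- fan-in ≥ 3 is excluded
      simp [Gate.fanIn, Gate.args] at hg

/-- **The offset invariant along the gate list** (Ben-Or–Cleve 1992, Thm. 1, induction on the
straight-line program): for a fan-in-two gate list, every gate reference `j` (junk references
included: value `0`, depth `0`) has, for every pair `i ≠ i'` and scalar `c`, an admissible word
of length `≤ 4 ^ depth_j` for `E_{i i'}(C c * value_j)`. -/
theorem word_of_gates (gs : List (Gate R σ)) (hgs : ∀ g ∈ gs, g.fanIn ≤ 2) (j : ℕ)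
    {i i' : Fin 3} (h : i ≠ i') (c : R) :
    ∃ w : List (Fin 3 × Fin 3 × R × Option σ),
      w.length ≤ 4 ^ (gateWDepths (fun _ => 1) gs).getD j 0 ∧ (∀ l ∈ w, l.1 ≠ l.2.1) ∧
      (w.map fun l => transvection l.1 l.2.1 (C l.2.2.1 * l.2.2.2.elim 1 X)).prod =
        transvection i i' (C c * (gateValues gs).getD j 0) := by
  induction gs using List.reverseRecOn generalizing j i i' c with
  | nil =>
    obtain ⟨w, hw, hv, hp⟩ := word_one (R := R) (σ := σ) 0
    refine ⟨w, hw.trans (Nat.zero_le _), hv, ?_⟩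
    rw [hp]
    simp [gateValues]
  | append_singleton gs g ih =>
    have hgs' : ∀ g' ∈ gs, g'.fanIn ≤ 2 := fun g' hg' => hgs g' (List.mem_append_left _ hg')
    have hg : g.fanIn ≤ 2 := hgs g (by simp)
    have hlen₁ := gateWDepths_length (fun _ : Gate R σ => 1) gs
    have hlen₂ := gateValues_length (k := R) gs
    rw [gateWDepths_append_singleton, gateValues_append_singleton]
    rcases Nat.lt_trichotomy j gs.length with hj | rfl | hj
    · -- an earlier gate
      rw [List.getD_append _ _ _ _ (by omega), List.getD_append _ _ _ _ (by omega)]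
      exact ih hgs' j h c
    · -- the new gate
      rw [List.getD_append_right _ _ _ _ (by omega), List.getD_append_right _ _ _ _ (by omega),
        hlen₁, hlen₂, Nat.sub_self, List.getD_cons_zero, List.getD_cons_zero]
      exact word_of_gate _ _ (fun j i i' h c => ih hgs' j h c) g hg h c
    · -- out of range: junk value `0`, depth `0`
      rw [List.getD_eq_default _ _ (by simp; omega), List.getD_eq_default _ _ (by simp; omega)]
      obtain ⟨w, hw, hv, hp⟩ := word_one (R := R) (σ := σ) 0
      refine ⟨w, hw.trans (Nat.zero_le _), hv, ?_⟩
      rw [hp]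
      simp

/-! ### The route decl -/

/-- **Ben-Or–Cleve, Thm. 1, on the tree's circuits** (route ElementaryWordLength, support item
`BocSimulation`, stmt-ValiantsHypothesis-6629): a fan-in-≤2 arithmetic circuit `P` over `ℂ` of
depth `d` computing `f` yields an admissible word of length `≤ 4 ^ d` in the letters
`E_ij(λ)`, `E_ij(λ·x_v)` (`i ≠ j`) whose product is the transvection `E_02(f)`. -/
theorem bocSimulation_proof :
    Summit.ValiantsHypothesis.ValiantsHypothesis.Theses.ElementaryWordLength.BocSimulation := by
  unfold Summit.ValiantsHypothesis.ValiantsHypothesis.Theses.ElementaryWordLength.BocSimulation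
  intro σ P f hP hf
  obtain ⟨w, hw, hv, hp⟩ := word_of_operand (gateValues P.gates) (gateWDepths (fun _ => 1) P.gates)
    (fun j i i' h c => word_of_gates P.gates hP j h c) P.output
    (show (0 : Fin 3) ≠ 2 by decide) (1 : ℂ)
  refine ⟨w, hw, hv, ?_⟩
  rw [hp, C_1, one_mul]
  exact congrArg (transvection (0 : Fin 3) 2) hf

end Summit.ValiantsHypothesis.ValiantsHypothesis.Theorems.ElementaryWordLengthBocSimulation

end
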